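import Summits.Ventures.DiscreteObjects.UnitDistance.FiniteFieldLowerBoundF19Piece1
import Summits.Ventures.DiscreteObjects.UnitDistance.FiniteFieldLowerBoundF19Piece2
import Summits.Ventures.DiscreteObjects.UnitDistance.FiniteFieldLowerBoundF19Piece3
import Summits.Ventures.DiscreteObjects.UnitDistance.FiniteFieldLowerBoundF19Piece4
import Summits.Ventures.DiscreteObjects.UnitDistance.FiniteFieldLowerBoundF19Piece5
import Summits.Ventures.DiscreteObjects.UnitDistance.FiniteFieldLowerBoundF19Piece6
import Summits.Ventures.DiscreteObjects.UnitDistance.FiniteFieldLowerBoundF19Piece7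
import Summits.Ventures.DiscreteObjects.UnitDistance.FiniteFieldLowerBoundF19Piece8
import Summits.Ventures.DiscreteObjects.UnitDistance.FiniteFieldLowerBoundF19Piece9
import Summits.Ventures.DiscreteObjects.UnitDistance.FiniteFieldLowerBoundF19Piece10
import Summits.Ventures.DiscreteObjects.UnitDistance.FiniteFieldLowerBoundF19Piece11
import Summits.Ventures.DiscreteObjects.UnitDistance.FiniteFieldLowerBoundF19Piece12
import Summits.Ventures.DiscreteObjects.UnitDistance.FiniteFieldLowerBoundF11
import HarnessLib

/-!
# `χ(unitCircleGraph (ZMod 19)) = 5` in the kernel — the last atlas killer value, lower bound by a kernel-evaluated search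

Framing (verbatim for the cell): lottery ticket; floor = certified bounds/negative ranges.

The (U) reduction atlas has four 'killer' residue fields: `χ(UD(F₃²)) = 3`, `χ(UD(F₇²)) = 4`, `χ(UD(F₁₁²)) = 5` (all kernel-exact,
`FiniteFieldLowerBounds.lean`, `FiniteFieldLowerBoundF11.lean`) and `χ(UD(F₁₉²)) = 5`, whose lower bound was so far a DRAT certificate
only (the plain backtracking tree exceeds `3·10⁷` nodes).  Here the lower bound enters the kernel: a DSATUR-type search with unit
propagation and the PASS tie-break on bit-vector states (`KernelColouringSearch.lean`, soundness `KBits.search_sound`) refutes every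
proper 4-colouring with `(0,0) ↦ 0`, `(1,0) ↦ 1`, `(0,1) ↦ 1 or 2` (WLOG by a colour permutation: `(1,0), (0,1)` are neighbours of
`(0,0)`), in ≈ 17,500 branch nodes split into twelve pieces (`ud19_piece1 … 12`, files `FiniteFieldLowerBoundF19Piece1…12.lean`,
each cut once more into ≤ 4 kernel facts of ≤ 0.7·10⁶ bit operations — one kernel evaluation must stay within memory) plus the root
run `ud19run_eq`.  With the kernel 5-colouring of `FiniteFieldColourings.lean`: `χ = 5` exactly, so ALL FOUR killer values are kernel theorems on both sides.
-/

namespace Summit.Ventures.DiscreteObjects.UnitDistance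

open SimpleGraph KBits

/-- The root run: propagate the initial forced colours, then search down to the twelve refuted states. -/
def ud19run : Bool :=
  match propagate ud19nb 40 (ud19C0, ud19C1, ud19C2, ud19C3, 2 ^ 361 - 1) with
  | none => true
  | some st => search ud19nb 361 40 [ud19Q1, ud19Q2, ud19Q3, ud19Q4, ud19Q5, ud19Q6, ud19Q7, ud19Q8, ud19Q9, ud19Q10, ud19Q11, ud19Q12] 361 st

set_option maxHeartbeats 400000000 in
set_option maxRecDepth 200000 in
/-- KERNEL FACT: the root run closes (every branch reaches a dead end or one of the five refuted states). -/
theorem ud19run_eq : ud19run = true := by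
  decide +kernel

set_option exponentiation.threshold 1024 in
/-- `unitCircleGraph (ZMod 19)` is not 4-colourable. -/
theorem not_colorable_four_zmod19 : ¬ (unitCircleGraph (ZMod 19)).Colorable 4 := by
  rintro ⟨C⟩
  have h0s : C (emb19 0) ≠ C (emb19 19) := C.valid (by decide)
  have h0w : C (emb19 0) ≠ C (emb19 1) := C.valid (by decide)
  obtain ⟨σ, hσ0, hσs, hσw⟩ : ∃ σ : Equiv.Perm (Fin 4), σ (C (emb19 0)) = 0 ∧ σ (C (emb19 19)) = 1 ∧
      (σ (C (emb19 1)) = 1 ∨ σ (C (emb19 1)) = 2) := by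
    by_cases hsw : C (emb19 19) = C (emb19 1)
    · obtain ⟨σ, h0, h1⟩ := exists_perm_fin4 _ _ h0s
      exact ⟨σ, h0, h1, Or.inl (by rw [← hsw, h1])⟩
    · obtain ⟨σ, h0, h1, h2⟩ := exists_perm_fin4_three _ _ _ h0s h0w hsw
      exact ⟨σ, h0, h1, Or.inr h2⟩
  let D := recolour C σ
  have hD : ∀ x, D x = σ (C x) := fun x => rfl
  let col : ℕ → ℕ := fun v => (D (emb19 v)).val
  have hP : Proper ud19nb 361 col := by
    intro v hv
    refine ⟨(D (emb19 v)).isLt, ?_⟩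
    intro w _ hbit heq
    exact D.valid (ud19_adj_of_testBit v w hv hbit) (Fin.ext heq).symm
  have hU : UBound 361 (ud19C0, ud19C1, ud19C2, ud19C3, 2 ^ 361 - 1) := by
    intro v hv
    change Nat.testBit (2 ^ 361 - 1) v = true at hv
    rw [Nat.testBit_two_pow_sub_one] at hv
    exact of_decide_eq_true hv
  have hC : Cons 361 col (ud19C0, ud19C1, ud19C2, ud19C3, 2 ^ 361 - 1) := by
    intro w hw _
    show Nat.testBit (getC ud19C0 ud19C1 ud19C2 ud19C3 (col w)) w = true
    rw [ud19_initBits w hw (col w) (hP w hw).1]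
    simp only [Bool.and_eq_true, decide_eq_true_eq]
    refine ⟨⟨fun h => ?_, fun h => ?_⟩, fun h => ?_⟩
    · subst h; show (σ (C (emb19 0))).val = 0; rw [hσ0]; rfl
    · subst h; show (σ (C (emb19 19))).val = 1; rw [hσs]; rfl
    · subst h; show (σ (C (emb19 1))).val = 1 ∨ (σ (C (emb19 1))).val = 2
      rcases hσw with h | h <;> rw [h]
      · exact Or.inl rfl
      · exact Or.inr rfl
  have hdone : ∀ d ∈ [ud19Q1, ud19Q2, ud19Q3, ud19Q4, ud19Q5, ud19Q6, ud19Q7, ud19Q8, ud19Q9, ud19Q10, ud19Q11, ud19Q12], UBound 361 d → Cons 361 col d → False := by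
    intro d hd
    simp only [List.mem_cons, List.not_mem_nil, or_false] at hd
    rcases hd with rfl | rfl | rfl | rfl | rfl | rfl | rfl | rfl | rfl | rfl | rfl | rfl
    · exact ud19_piece1 hP
    · exact ud19_piece2 hP
    · exact ud19_piece3 hP
    · exact ud19_piece4 hP
    · exact ud19_piece5 hP
    · exact ud19_piece6 hP
    · exact ud19_piece7 hP
    · exact ud19_piece8 hP
    · exact ud19_piece9 hP
    · exact ud19_piece10 hP
    · exact ud19_piece11 hP
    · exact ud19_piece12 hP
  have hrun := ud19run_eq
  unfold ud19run at hrun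
  split at hrun
  · rename_i hnone
    exact (propagate_sound hP 40 _ hU hC).1 hnone
  · rename_i st hst
    obtain ⟨hU', hC'⟩ := (propagate_sound hP 40 _ hU hC).2 st hst
    exact search_sound hP hdone 361 st hrun hU' hC'

/-- ATLAS KILLER VALUE, KERNEL-EXACT: `χ(unitCircleGraph (ZMod 19)) = 5` (upper bound: the kernel 5-colouring of
`FiniteFieldColourings.lean`; lower bound: `not_colorable_four_zmod19`). -/
theorem chromaticNumber_unitCircleGraph_zmod19 : (unitCircleGraph (ZMod 19)).chromaticNumber = 5 := by
  have h5 : (unitCircleGraph (ZMod 19)).Colorable 5 := unitCircleGraph_zmod19_colorable_five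
  apply le_antisymm h5.chromaticNumber_le
  by_contra hlt
  have hlt' : (unitCircleGraph (ZMod 19)).chromaticNumber < (4 : ℕ∞) + 1 := lt_of_not_ge hlt
  have hle : (unitCircleGraph (ZMod 19)).chromaticNumber ≤ (4 : ℕ) := Order.le_of_lt_add_one hlt'
  exact not_colorable_four_zmod19 (chromaticNumber_le_iff_colorable.mp hle)

end Summit.Ventures.DiscreteObjects.UnitDistance
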